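import Mathlib
import HarnessLib
import HarnessLib.Audit
import Summits.ValiantsHypothesis.Statement

/-!
Route: FeketeSOS

DORMANT since 2026-09-02T21:52:24Z (reconciler: no traction for 5 d (last activity statement-checked at 2026-08-28T21:09:06Z); parked, not closed — `ledger route dormant route-ValiantsHypothesis-FeketeSOS --off` to reactivate) — unstaffed, not closed; items shared with open routes are served there. `ledger route dormant <id> --off` reactivates.

# Route FeketeSOS — Fekete polynomials are SOS-hard — quadratic residues are not a short sum of
sparse squares, magnified by Dutta–Saxena–Thierauf

It suffices to show X = FeketeSOSHard (card fekete-sos-hardness, K1): there is δ > 0 such that for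
every large prime p the
Fekete polynomial F_p(x) = Σ_{m<p} (m|p) x^m ∈ ℂ[x] admits no weighted sum-of-squares representation
F_p = Σ_{i<s} c_i g_i²
(c_i ∈ ℂ, g_i ∈ ℂ[x]) with at most s ≤ p^δ squares of degree ≤ p² and support-sum Σ_i |supp g_i| <
p^{1/2+δ} — an exponent
gain over the trivial counting bound √(2p) in the Dutta–Saxena–Thierauf SOS model, restricted (as
their proof allows) to few
squares of bounded degree. X → VP_ℂ ≠ VNP_ℂ is their magnification theorem specialised to this
family (item SOSMagnification,
rank 2: all seven registered stubs are ACCEPTED theorems — p78989, p76871, p76453, p78996, p76688,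
p76797, p77095 — and only the
kernel-checked composition `Theorems/FeketeSOSSOSMagnification.lean` awaits resubmission after two
gate-restart bounces
p79173/p79388). STATE 2026-08-16: the tier-deciding milestone FeketeNoSparseSplit (s = 2, sparse
splittings F_p = A·B) is a
THEOREM with the LINEAR bound |supp A| + |supp B| ≥ (p+3)/2 (δ = 1/4, p₀ = 16; stubs p81547 p80625
p80910 p82759 accepted,
closing file p84211 pending) by the CHAR-p MULTIPLICITY LEVER: at a place of ℂ above p, Euler's
criterion χ_p(m) ≡ m^{(p−1)/2}
makes F̄_p vanish at x = 1 to order exactly (p−1)/2, while a polynomial of degree < p with t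
monomials vanishes there to order
≤ t − 1 (Hajós in characteristic p). X is now split along the same lever into two sharper cruxes:
(★) CharPSparseSOS — over
any field of characteristic p, no cyclic representation Σ_{i<s} c_i g_i² ≡ F̄_p (mod x^p − 1) with s
≤ p^δ squares of degree
< p has support-sum < p^{1/2+δ} (equivalently: the monomial z^{(p−1)/2} of k[z]/(z^p) is not a short
sum of squares of
sparse exponential sums) — and SublinearShadow — every complex representation of support-sum ≤
p^{3/4} has a
characteristic-p shadow with ≤ (s+1)^A squares and total support ≤ (s+1)^A times its own (depth 0 =
good reduction is
provable now; positive p-adic depth = de-bordering is the open core). CharPSparseSOS →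
SublinearShadow → X is proved
(planner Sketch.lean, lean rc 0) and inlined in `closes`.
Lean: `∃ δ : ℝ, 0 < δ ∧ ∃ p₀ : ℕ, ∀ (p : ℕ) [Fact p.Prime], p₀ ≤ p → ∀ (s : ℕ) (c : Fin s → ℂ) (g :
Fin s → Polynomial ℂ), (s : ℝ) ≤ (p : ℝ) ^ δ → (∀ i, (g i).natDegree ≤ p ^ 2) → (∑ i, Polynomial.C
(c i) * g i ^ 2) = ∑ m ∈ Finset.range p, Polynomial.C ((legendreSym p m : ℤ) : ℂ) * Polynomial.X ^ m
→ (p : ℝ) ^ (1 / 2 + δ) ≤ ∑ i, ((g i).support.card : ℝ)`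

## Assembly
`closes (h₁ : SOSMagnification) (h₂ : CharPSparseSOS) (h₃ : SublinearShadow) : ValiantsHypothesis`
DERIVES X inside the proof
(glued split, ≈ 90 lines of real-exponent bookkeeping: δ = min(1/4, δ'/(2(A+1))), threshold 2^A ≤
p^{δ'/2}; a cheap complex
representation is sublinear, hence has a shadow with d ≤ (s+1)^A ≤ p^{δ'} squares and support ≤
(s+1)^A·S < p^{1/2+δ'},
contradicting (★)) and then applies h₁ (modus ponens; SOSMagnification is literally X →
ValiantsHypothesis with X inlined).
FeketeSOSHard stays an item (parent of the split, directly claimable: a direct proof re-glues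
`closes` back to (h₁)(h₂ : X) in
one edit). The Assembly item (stmt-14917, restated at rev 4) is FeketeSOSHard → ValiantsHypothesis,
i.e. SOSMagnification over the
decl X (closes the moment stmt-3995 lands; the legacy tautological Assembly stmt-4002 is proved,
p81536). FeketeNoSparseSplit
(theorem) and FeketeBoundedFanin (rung, line witt-pascal-ufa) are milestones = necessary conditions
of X, kind support (rev 2).

Rationale: WHY THIS LINE. Dutta–Saxena–Thierauf (DuttaSaxenaThierauf2021 Thm 6; DuttaSaxenaThierauf2024 Thm
3.2/3.9, Lemma 3.1/3.8) magnify a barely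
super-trivial support-sum lower bound for ONE explicit univariate family into VP ≠ VNP with the
constants c_i free; for the Fekete family this
bridge is now kernel-checked mathematics in the tree (SOSMagnification: seven stubs accepted,
composition pending resubmission — growing-radix
one-hot digit lift of F_{p_n} with Bertrand primes (n+1)^n/2 < p_n ≤ (n+1)^n, VNP-membership by
Valiant's criterion with a Boolean mod-p
circuit for Euler's criterion, transfer by the VSBR middle cut + set-multilinear projection +
polarisation + inverse Kronecker). The ENGINE
of the lower bound is no longer the additive-combinatorial framing of rev 1 (characters give
constants at |S| ~ √p; worse, everything F_p
shares with the all-ones pattern — unimodular coefficients, support [1,p−1], the counting layer — is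
cheap: Σ_{1≤m<p} x^m is 4 squares of
support-sum ≤ 6√p + 4 by digit tiling, Theorems/FeketeSOSHard/Negative/LoadBearing.lean) but
ARITHMETIC AT THE PLACE OVER p, found and
proved overnight on the s = 2 milestone: reduce a representation at a valuation ring of ℂ above p
(tree Literature.RingTheory.Valuation:
exists_valuationSubring_natCast_mem_maximalIdeal, charP_residueField, gaussVal); in characteristic
p, X^p − 1 = (X − 1)^p and Euler's
criterion χ_p(m) ≡ m^{(p−1)/2} give F̄_p = (X·d/dX)^{(p−1)/2}((X−1)^{p−1}), which vanishes at X = 1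
to order EXACTLY (p−1)/2 — ±χ_p are
the only ±1 patterns on [1,p−1] reaching this ceiling
(Theorems/FeketeNoSparseSplit/Negative/LegendreExtremiser.lean, LeverCeiling.lean; in
sequence language ord₁ = p − L with L the 𝔽_p-linear complexity of the Legendre sequence,
AlyWinterhof2006) — while a polynomial of degree
< p with t monomials vanishes at 1 to order ≤ t − 1 (Hajós's lemma, Hajos1953, survives in
characteristic p below degree p — in print as 'cyclic codes of length p over 𝔽_p are MDS',
RothSeroussi1986, MasseyCostelloJustesen1973; landed as
FeketeNoSparseSplitCyclic.stub_charPFewnomial p81547; the exact order (p−1)/2 of F̄_p is in print as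
MinacNguyenDuytan2023 Prop. 5.1/Cor. 5.2, arXiv:2111.05256 p. 17, and landed as stub_feketeModPOrder
p80625). One product: ord A + ord B = (p−1)/2 forces
|supp A| + |supp B| ≥ (p+3)/2, i.e. FeketeNoSparseSplit with δ = 1/4 (MinacNguyenDuytan2023 have the
multiplicity, not the sparsity
consequence). For SUMS of squares the same two facts give, at every place and weight, a
FAT-OR-CANCEL DICHOTOMY (support item
CharPSOSOrderDichotomy, provable now): either some square has ≥ (p+3)/4 monomials or the
minimal-order initial forms cancel — so every cheap
representation is TOTALLY CANCELLING, i.e. a border decomposition of the monomial z^{(p−1)/2} in the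
local algebra k[x]/(x^p − 1) ≅
k[z]/(z^p) (x = e^z; F̄_p = −z^{(p−1)/2}/((p−1)/2)! exactly; a t-sparse g is a t-term exponential
sum, an element of a d/dz-stable space with
spectrum its support ⊂ 𝔽_p). The thesis therefore splits into (★) CharPSparseSOS — sparse-SOS
hardness of ONE MONOMIAL in a p-dimensional
truncated algebra over a finite field's closure, where Hajós, Wronskians/divide-and-derive
(KoiranPortierTavenas2015, Koiran2011 for
the real analogue) and exhaustive search are exact tools — and SublinearShadow, a de-bordering
transfer in the sense of border complexity
(bounded top fan-in de-bordering, DuttaDwivediSaxena2022, is the model; Witt/Teichmüller digit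
descent the proposed vehicle). Imported:
valuation theory and char-p fewnomial theory as the lower-bound engine, border/Witt techniques for
the transfer, algebraic complexity only
through the DST bridge. Versus prior routes (Elusive/TauConst/Depth4/UlrichPadded/BorderApolarity):
no rank-of-flattening measure, no
real-zero counting, no orbit closure of det — a multiplicity argument about one integer polynomial
at one prime, magnified.

RANKED CRUXES. #2 SOSMagnification (crux) — DST magnification for the Fekete family: X → VP_ℂ ≠
VNP_ℂ. STATUS: PROVED modulo resubmission —
line sml-polarised-transport, stubs stub_legendreCircuit p78989, stub_oneHotLtCircuit p76871,
stub_circuitSumIdentity p76453,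
stub_vnpAssembly p78996, stub_digitKronecker p76688, stub_polarisedSOS p76797, stub_budget p77095
ACCEPTED under
Theorems/FeketeSOSSOSMagnificationStub*.lean; the composition FeketeSOSSOSMagnification.lean bounced
twice for gate restart only (p79173,
p79388); budget true for every δ > 0 (δ ≤ 1/2 needed nowhere). [difficulty: XL → done] (why it might
fail: only Lean plumbing remains; the
mathematical risks of rev 1 — prime-only indexing, few-squares restriction, Remark-2 degree bound —
were all discharged by the stubs.)
[DuttaSaxenaThierauf2021, DuttaSaxenaThierauf2024, Valiant1979, Burgisser2000,
ValiantSkyumBerkowitzRackoff1983]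
#3 FeketeSOSHard (crux; the thesis X, parent of the glued split #4 → #5 → X, directly claimable) — ∃
δ > 0 ∃ p₀ ∀ primes p ≥ p₀, every
F_p = Σ_{i<s} c_i g_i² over ℂ with s ≤ p^δ squares of degree ≤ p² has Σ_i |supp g_i| ≥ p^{1/2+δ}.
Structure now available: counting
(TrivialSupportBound, ThinSquaresCovering ✓: only representations carrying a square with ≥ p^{1/2−δ}
monomials matter); s = 2 ⇒ (p+3)/2
(theorem); every place over p sees F̄_p at exact depth (p−1)/2, half-way to the socle; cheap ⇒
totally cancelling at every place, weight and
conjugate (dichotomy). [difficulty: open-problem] (why it might fail: a Gauss/Jacobi-sum identity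
could write F_p with p^{o(1)} squares of
~√p-sparse g_i, p-adically cancelling at every place (the quartic Jacobi square Ψ² ≡ J·F_p mod x^p −
1 is dense but shows cancelling
identities exist); no de-bordering engine beyond bounded fan-in is known.) [DuttaSaxenaThierauf2024,
MinacNguyenDuytan2023, ConreyEtAl2000,
HansonPetridis2020, DuttaDwivediSaxena2022]
#4 CharPSparseSOS (crux, NEW — (★), the char-p shadow; child 1 of X) — ∃ δ > 0 ∃ p₀ ∀ p ≥ p₀ ∀
fields K of characteristic p ∀ s ≤ p^δ,
c : Fin s → K, g_i ∈ K[X] of degree < p: X^p − 1 ∣ Σ c_i g_i² − F̄_p ⇒ Σ|supp g_i| ≥ p^{1/2+δ}. WHY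
THIS FORM IS EASIER (it is neither weaker
nor stronger than X: a transfer target): finite field, cyclic, no archimedean place, no Galois
bookkeeping; the target is a MONOMIAL
z^{(p−1)/2} in k[z]/(z^p) and the unknowns live in eigenspaces of d/dz, so Hajós, Wronskians and
divide-and-derive are exact; finitely and
exhaustively falsifiable at each p. Status: s = 1 needs |S| ≥ (p+1)/2 (the moment sequence of g is
an LRS of order |S| with (p−1)/2 forced
zeros); s = 2 ⇔ one product ⇒ (p+3)/2 (landed); non-cancelling representations ⇒ some |supp g_i| ≥
(p+3)/4 (dichotomy); every exhaustive
case is LINEAR ≈ 0.7p (product + square patterns, p ≤ 23, kit j012005/j012003/j012007); no cheap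
digit identity exists for 100 ≤ p < 4000
(rank over 𝔽_p of all 7350 digit matrices (χ_p(u+av)) equals the rank over ℚ, full for p ≥ 700).
Conjectured truth: the LINEAR form
(p+3)/4 ≤ Σ|supp g_i| for every odd p and every s (not filed; its refutation re-ranks, does not
break). First lemma Monday morning:
CharPSOSOrderDichotomy (support, typed, provable now from landed cpf_main + stub_feketeModPOrder +
rootMultiplicity additivity); candidate
engines: the socle-window order–sparsity inequality UFA♯ for t products (= registered stub_splitGap
of line witt-pascal-ufa on
FeketeBoundedFanin: exact (X−1)-order m ≤ C₀(t)·Σ(|A_l|+|B_l|) unless m ≥ p−1−B₀(t)), with C₀(t)·t ≤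
p^{1/2−2δ} sufficing for (★);
Wronskian/ODE order in z restricted to depth ≤ (p−1)/2; the LRS/linear-complexity argument that
settles s = 1. [difficulty: XL] (why it
might fail: in char p order-vs-sparsity inequalities for ≥ 2 products are FALSE near the socle —
(X−1)^{p−1} = [a]_x[b]_{x^a} + x^{ab}[c]_x,
support ≤ 3√p+3, and θ^j of it has exact order p−1−j with ≤ 2(j+1) products
(Negative/UnipotentFewnomialABCFalse, SocleTiling) — so the
invariant must die at the socle yet bite at depth (p−1)/2; none is known, and Paley-type
sign-pattern questions may hide in it.)
[DuttaSaxenaThierauf2024, KoiranPortierTavenas2015, Koiran2011, AlyWinterhof2006,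
MinacNguyenDuytan2023,
Summits/ValiantsHypothesis/ValiantsHypothesis/Cruxes/FeketeSOSHard/Ideas/border-depth-dichotomy.md,
Summits/ValiantsHypothesis/ValiantsHypothesis/Cruxes/FeketeBoundedFanin/Lines/witt-pascal-ufa.md]
#5 SublinearShadow (crux, NEW — de-bordering transfer; child 2 of X) — ∃ A, p₁ ∀ primes p ≥ p₁ ∀ s,
c, g (deg g_i ≤ p²) with
(Σ|supp g_i|)⁴ ≤ p³ and Σ c_i g_i² = F_p over ℂ, there are a field K of characteristic p, d ≤
(s+1)^A, c′ : Fin d → K and g′_j ∈ K[X] of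
degree < p with Σ_j |supp g′_j| ≤ (s+1)^A · Σ_i |supp g_i| and X^p − 1 ∣ Σ c′_j g′_j² − F̄_p.
Content: a complex representation of sublinear
cost has a characteristic-p representation of polynomially comparable cost. DEPTH 0 (some valuation
ring O ∋ p/𝔪 of ℂ makes every term
c_i g_i² O-integral) is provable now with d = s, A = 1 (support item DepthZeroShadow: per-term Gauss
normalisation c_i g_i² = (c_i a_i²)·h_i²
with h_i primitive, residue map, fold exponents mod p — the sibling's stub_primitiveReduction p82759
is the one-product case verbatim);
POSITIVE DEPTH (the terms cancel p-adically at every place: modulo p the representation is a border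
decomposition Σ ĉ_i G_i(Π)² = Π^v·unit·F̄_p
over Λ = k[Π]/(Π^e)) is the open core: descend through the cancelling layers (Teichmüller digits of
fewnomials are fewnomials on the same
supports; Gauss-orthonormal basis of span(g_i) by the maximal-minor trick, cost ≤ factor s) to the
first layer where F̄_p appears, or bound
the depth by minimality. Invariance checks passed at design time: the statement asks for EXISTENCE
of a shadow, so the two costume
generators — padding c·h² − c·h² with c = 1/p (which makes "X restricted to everywhere-bad
reduction" equivalent to X) and the hyperbolic
rescaling (A, B) ↦ (λA, B/λ) inside a Witt pair (which makes coefficient-wise good reduction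
non-invariant) — do not touch it.
[difficulty: L (depth 0: M)] (why it might fail: forced cancellation of unbounded depth —
constituents congruent mod 𝔭 (Σ_j χ(j)U_p(ζ^j x) =
G·F_p with v(G⁻¹) < 0; the Jacobi square has depth 1 at 𝔭 | J); border lower bounds beyond
flattenings have no general engine (GCT
experience), DuttaDwivediSaxena2022 Thm 1.1 de-border only bounded top fan-in; a liftability
statement for cheap covering syzygies is unformulated (Witt carry
(2−[2])/p ≠ 0 at p = 103, r = 5, T = 57).) [DuttaDwivediSaxena2022, DuttaSaxenaThierauf2024,
MinacNguyenDuytan2023,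
Literature/RingTheory/Valuation/AlgClosedResidue.lean,
Literature/RingTheory/Valuation/RootReduction.lean,
Summits/ValiantsHypothesis/ValiantsHypothesis/Cruxes/FeketeSOSHard/TRIAGE-r1-2.md]
#4s FeketeNoSparseSplit (support; was crux r4, the tier-deciding milestone) — THEOREM: every complex
splitting A·B = F_p has |supp A| +
|supp B| ≥ (p+3)/2 ≥ p^{3/4} (p ≥ 16); line cyclic-valuation-dichotomy, stubs p81547 p80625 p80910
p82759 accepted, closing
Theorems/FeketeSOSFeketeNoSparseSplit.lean p84211 pending. Boundary (all PROVED,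
Theorems/FeketeNoSparseSplit/Negative/*): admissible δ is
exactly (0, 1/2) (ExponentHalf); "≥ p − K eventually" false for every K (UnboundedDeficiency, peel
F_p = (X − X²)·Σ S_p(k+1)X^k); the place must
lie over p (ModTwoShadow, ModThreeShadow: F₁₉ splits 4 + 6 = 10 < 11 mod 3); the values of χ_p and
the primality of p are load-bearing
(FalseWithoutLegendre: unimodular witness ≤ 2√p+2; Jacobi N = 15, 9); the lever's certificate
(p+3)/2 vs truth: complex minima
3,4,7,9,10,14,15,23,22 (p = 3…29, exhaustive), char-p minima 3,4,7,9,10,13,13,21,22,25 (p ≤ 31;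
CharPShadow: F̄₁₇ splits with 13 < 14).
[MinacNguyenDuytan2023, ConreyEtAl2000, DuttaSaxenaThierauf2024]
#5s FeketeBoundedFanin (support; rung s ≤ s₀ fixed) — lead line witt-pascal-ufa (4 stubs:
stub_nonCancellingReduction [depth 0 provable,
positive depth open], stub_wittFold [Witt pairing c₀v₀² + c₁v₁² = (av₀ + ibv₁)(av₀ − ibv₁) into
⌈d/2⌉ products, provable],
stub_feketeExactOrder [provable], stub_splitGap = UFA♯ [load-bearing, open]; FeketeBoundedFanin_of
kernel-checked modulo the stubs, δ = 1/4).
Negative (PROVED): signs and primality load-bearing (all-ones at s₀ = 4 ≤ 8k+2 < 11√p; Jacobi q² at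
s₀ = 2 ≤ 4q−2), s₀ = 0, 1 vacuous, s₀ = 2
inhabited with ceiling 2p + 2, ReciprocalRigidity and the un-windowed unipotent fewnomial abc FALSE
(Frobenius X·X^{p−1}; socle tiling).
[DuttaSaxenaThierauf2024, HansonPetridis2020]
#9 TrivialSupportBound (support, open, provable-now: S(S+1)/2 ≥ p − 1), ThinSquaresCovering ✓
(thinSquaresCovering_proof), SplitOfTwoSquares ✓
(p79780), CharPSOSOrderDichotomy (support, NEW, provable-now, first lemma of #4), DepthZeroShadow
(support, NEW, provable-now [M], depth-0 case
of #5). #1 Assembly (stmt-14917, restated at rev 4 as FeketeSOSHard → ValiantsHypothesis =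
SOSMagnification over the decl X; closes the moment
3995 lands; the legacy tautological form stmt-4002 is proved, p81536). [DuttaSaxenaThierauf2024]

TWO-LAYER PLAN. FILED in this revision: FeketeSOSHard ⇐ CharPSparseSOS → SublinearShadow →
FeketeSOSHard, glue PROVED (planner folder
Sketch.lean `feketeSOSHard_of_charP_of_shadow`, lean rc 0, axioms standard) and inlined in `closes`:
δ = min(1/4, δ′/(2(A+1))),
p₀ = max(p₀′, p₁, ⌈(2^A)^{2/δ′}⌉, 2); a representation with S < p^{1/2+δ} has S⁴ ≤ p³, hence a
shadow with d ≤ (s+1)^A ≤ 2^A p^{Aδ} ≤ p^{δ′}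
squares and support ≤ (s+1)^A S < p^{δ′/2} p^{Aδ+1/2+δ} ≤ p^{1/2+δ′}, contradicting (★) in K.
Foreseen (tenure, not filed): CharPSparseSOS ⇐
SocleWindowBound (UFA♯ with C₀(t)·t polynomial) → dichotomy glue; SublinearShadow ⇐ DepthZeroShadow
(filed as support) ∧ BorderDescent
(0 < v < v(p): digit descent in W₂…W_e / semicontinuity along Π for flattening-type certificates) ∧
DeepCase (v ≥ v(p): minimality, Witt
peeling). k ≤ 3, depth 1 each.

KILL CRITERIA. (i) An explicit family of complex representations with s ≤ p^δ squares and
support-sum p^{1/2+o(1)} for infinitely many p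
(every δ) refutes FeketeSOSHard — close `refuted:FeketeSOSHard`; the identity goes to the negatives
index (it would be a new Gauss-sum-type
identity; Theorems/FeketeSOSHard/Negative/KillCriterion.lean pins its shape: r cheap PRODUCTS
suffice, e.g. a rank-r factorisation of a
tiling matrix (χ_p(1+u+v))_{u∈S₁,v∈S₂}; measured ranks ≈ min(|S₁|,|S₂|), none known). (ii) ONE
family of cheap characteristic-p cyclic
representations (s ≤ p^δ, Σ|supp| = p^{1/2+o(1)}) refutes CharPSparseSOS → route BROKEN; repair =
re-glue `closes` to (h₂ : FeketeSOSHard)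
and record that the mod-p layer is dead for sums (then the line has no engine left and is a
candidate for `exhausted`). A refutation of the
LINEAR form (p+3)/4 alone re-ranks #4, nothing else. (iii) A complex representation with Σ|supp| ≤
p^{3/4} admitting no shadow within the
(s+1)^A slack for every A refutes SublinearShadow (and exhibits a sublinear SOS representation of
F_p — X itself would then hang by δ < 1/4):
BROKEN → resplit X by depth with explicit minimality. (iv) The live CHEAP kill of X stays bounded
fan-in: an explicit family F_p = Σ_{i<s₀} c_i g_i² for a fixed s₀ (s₀ = 3: A·B + c·C²; s₀ = 4:
A₁B₁ + A₂B₂) with support-sum p^{1/2+o(1)} refutes the support item FeketeBoundedFanin and thereby X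
(feketeSOSHard_false_of_cheapProducts).
(v) SOSMagnification can no longer fail mathematically (stubs landed). VP ≠ VNP proved
elsewhere moots the route; an SOS-hard family proved for another explicit f_d (Σ2^{i²}x^i,
Pochhammer–Wilkinson) supersedes it.

NOT DECOMPOSED YET. UFA♯ / the socle-window inequality is a registered STUB (stub_splitGap, crux
3998's line), not an item — it becomes
#4's child only if the 3998 lead's kit search for super-linear middle-order configurations at t = 2
(beyond p ≤ 17, T ≤ 6) comes back clean;
the LINEAR form of (★); BorderDescent / DeepCase of #5 (no typed minimality notion yet); the cyclic
relaxation over ℤ; the s = 3 case as its own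
rung (three weighted squares over an algebraically closed field = product + square, already the
pattern of the exhaustive searches).
Definitions: both rev-1 requests now EXIST — Literature.NumberTheory.LFunctions.feketePolynomial
(coeff_/support_/natDegree_/
map_feketePolynomial_complex, eval_one_feketePolynomial) and
Literature.Computability.AlgebraicComplexity.SOSDecomposition (sosSupportSum,
sosSupportSum_le); the items keep the inlined sums, equal to the tree objects by
map_feketePolynomial_complex.

CHEAPEST FALSIFIER. (a) For (★) in its linear form, at the first primes where (p+3)/4 exceeds
counting: p = 37 (T ≤ 9; after the s = 1
exclusion only the size pattern (8,1) passes coverage), p = 41 ((9,1)), p = 53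
((12,1),(11,2),(11,1,1),(10,3),(10,2,1),(10,1,1,1),(9,4),(9,3,1))
— supports modulo x ↦ x^λ (≈ C(37,8)/36 ≈ 10⁶ at p = 37), each a tiny Gröbner/linear feasibility
test over 𝔽̄_p: ONE batched kit job; a feasible
pattern kills the linear form, feasibility persisting at Σ|supp| ≤ p^{0.6} for several p threatens
#4 itself. (b) Extend the exhaustive cyclic
searches εF̄_p ≡ A·B + C·D (two products = four squares) to p = 13, 17 and to 𝔽_{p²} coefficients
(TRIAGE-r1-2 of crux 3996). (c) For #5:
mass-produce generic sparse-basis Gram solutions (gram_depth_probe.py of the border-depth card: p =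
13, 17, bases S with S + S ⊇ [1,p−1], all
of p-adic depth 0 while ℓ-adically deep at ℓ = 2, 3) — a generic-looking family whose p-adic depth
grows with p would show DeepCase is where
counterexamples hide. Already run (evidence on items 3995–3998): exhaustive complex splittings p ≤
29, char-p splittings p ≤ 31, digit-rank censuses (0/7350
deficient over 𝔽_p; j007992 ≈ full rank up to p = 39043), tiling-rank census j009416 (best SOS bound
from any mixed-radix tiling ≥ 2.22(p−1)),
exact small-model searches for cheap fixed-fan-in representations j010035–8 (Gröbner), j009087
(S_min(F_5) = 5, S_min(F_7) = 7, S_min(F_11) ≥ 9),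
socle/θ-ladder checks, Witt-carry counterexample (p = 103), product+square searches p ≤ 23 — no √p
economy found anywhere.

NUMBERS. Trivial: S(f) ≥ √(sp f), S(F_p) ≥ √(2(p−1)) − 1/2; generic S = Θ(d); S ≤ 2·sp + 2 (DST24
(2),(3)). Magnification thresholds (DST24): gain
ω(1/√log d) ⇒ VBP ≠ VNP (Cor 3.6); ω(√(log log d/log d)) ⇒ VP ≠ VNP (Thm 3.2); constant ⇒ 2^{Ω(n)}
(Thm 3.9). s = 2: certificate (p+3)/2, truth
p − Θ(√p) typically (mean #zeros of S_p ≈ 1.28√p, p < 4000), admissible δ ∈ (0, 1/2). Characteristic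
p: ord₁ F̄_p = (p−1)/2 exactly; Hajós ord₁ g ≤
|supp g| − 1 (deg < p), tight at (X−1)^m; socle (X−1)^{p−1}: 2 products, support ≤ 3√p + 3; order
p−1−j: ≤ 2(j+1) products, support ≤ 3(j+1)√p
(verified p = 101, 211, 307, j ≤ 8); (★) minima: product+square 6, 8, 10, 12 at p = 7, 11, 13, 17,
pattern (2,·,1) 11, 15, 14, 20 at p = 13, 17,
19, 23; s = 1 ⇒ ≥ (p+1)/2. Cheap non-Fekete patterns: all-ones 4 squares ≤ 6√p + 4; unimodular {1,
1+ω, ω} splitting ≤ 2√p + 2; Jacobi q²: 2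
squares ≤ 4q − 2. Zeros of F_p on |z| = 1: κ₀ ∈ (0.500668, 0.500813) (ConreyEtAl2000). Fixed s₀ = 3
shapes (1−x^f)·B + c·C²: minima ≈ 0.7p…p for
p ≤ 61 (disprover small models). Items after this revision: 12 (4 crux incl. the proved-pending
SOSMagnification and the parent X, 7 support of
which 2 closed, 1 assembly open = stmt-14917; legacy assembly stmt-4002 proved).

DEFINITION REQUESTS. None outstanding (see NOT DECOMPOSED YET: feketePolynomial and sosSupportSum
landed). Wanted as Literature FACTS (cite
items, not conjectures): Hajós's lemma in characteristic p for degree < p (now a Theorems lemma,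
cpf_main — could be promoted to
Literature/Algebra/Polynomial); the 𝔽_p-linear complexity (p+1)/2 of the Legendre sequence
(AlyWinterhof2006 / Ding–Helleseth–Shan) as the
published form of stub_feketeModPOrder.

Novelty: Searches (2026-08-16, this revision; rev-1 searches of 2026-08-15 retained below): `lit search
--hybrid "linear complexity Legendre sequence Euler
criterion multiplicity"` (12 docs, vector leg only — FTS leg busy; nothing on F_p mod p beyond
coding-theory textbooks: garcia2006 pp.122–133,
golomb2014); `lit search "linear complexity Legendre sequences" --source all` ×2 → rc 75 (searchd
unavailable 06:45–07:05Z, recorded, not worked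
around); `lit cite` 10.1007/s10623-006-0023-5, 10.1016/j.jsc.2014.09.036,
10.1109/FOCS52979.2021.00018, 10.1109/18.669398 (Crossref OK → bib
AlyWinterhof2006, KoiranPortierTavenas2015, DuttaDwivediSaxena2022, DingHellesethShan1998 +
Hajos1953 added, commit 4e243fb852f1); `lit read
arxiv:2111.05256` (MinacNguyenDuytan2023, held, 19 pp: Prop. 5.1/Cor. 5.2 p.17 — f_p ≡
(x−1)^{(p−1)/2−r_p} g mod p by Euler's criterion and power
sums, used there for discriminants and Galois groups only); `lit read arxiv:1205.1015`
(KoiranPortierTavenas2015, held, 18 pp: Wronskian bounds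
for real roots of sums of products of sparse polynomials, char 0); `lit read
10.1109/FOCS52979.2021.00018` (DuttaDwivediSaxena2022 journal
version, held via galaxy pdf 7641649743695546420, 60 pp: Thm 1.1 border of Σ^[k]ΠΣ ⊆ VBP, DiDIL);
`lit read 10.1007/s10623-006-0023-5`
(AlyWinterhof2006: paywalled, no OA copy → want acq-05843); `ledger negatives --problem
ValiantsHypothesis` (4, unrelated); the crux workfiles
of 3995/3996/3997/3998 (4 + 4 + 5 + 9 idea cards, 8 triage reports, 4 Dispro  [refs: 10.1007/s10623-006-0023-5, 10.1016/j.jsc.2014.09.036, 10.1109/FOCS52979.2021.00018, 10.1109/18.669398, 10.1109/FOCS52979.2021.00018`, 10.1007/s10623-006-0023-5`, 2111.05256, 1205.1015, 2601.00387, 1702.05827, 2206.11778, 2307.14896, arxiv:2111.05256, arxiv:1205.1015, AlyWinterhof2006, KoiranPortierTavenas2015, DuttaDwivediSaxena2022, DingHellesethShan1998, Hajos1953, MinacNguyenDuytan2023, ConreyE]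

Barriers (technique_class: char-p multiplicity, fewnomial, de-border, SOS-magnification): - technique_class: char-p multiplicity, fewnomial, de-border, SOS-magnification
- Literature.Barriers.ValiantsHypothesis.TauRealZeros: evaded — nothing archimedean is counted; the
certificate is the (X−1)-adic order of the reduction at a place over p (bigraded initial form
Y^{(p−1)/2}), the measure is DST's support-sum, and the family-specific input (Euler's criterion)
fails for a generic ±1 polynomial (ord₁ ≤ 2 typically; LeverCeiling: ≤ (p−1)/2 always, = only for
±χ_p), i.e. the lever is as non-natural as D-0021 asks. Chebyshev polynomials are dense (S = Θ(d))
and irrelevant to the measure.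
- Literature.Barriers.ValiantsHypothesis.AlgebraicNaturalProofs: not engaged — (★)/X concern ONE
integer polynomial per prime; the distinguishing property "reduction mod p has exact order (deg+1)/2
at 1" is constructive but violently non-large (2 of 2^{p−1} sign patterns, LegendreExtremiser), so
no FSV-type succinct hitting set obstruction applies; the magnification step is DST's theorem, not a
natural property.
- Literature.Barriers.ValiantsHypothesis.DepthReductionChasm: not applicable in letter (univariate
Σ∧²ΣΠ support-sum, trivial bound √d not tight: generic Θ(d); magnification by multilinearisation,
not the depth-4 chasm whose Kumar–Saraf tightness concerns homogeneous ΣΠΣΠ at degree ~√d); in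
spirit honoured: the bound must beat the trivial threshold by d^δ only, and the s = 2 rung beats it
by d^{1/2}.
- Literature.Barriers.ValiantsHypothesis.RankMethods / RankLiftingBarrier / Part

History (route lifecycle, newest last):
- 2026-08-16T06:46:59Z · rev 4: restated Assembly (stmt-ValiantsHypothesis-4002 proved) — route-repair (ground-failed): payload.ground's ONLY flag is Assembly = ground.trivial (tauto) — in this bridge-crux route SOSMagnification := (FeketeSOSHard-bod (planner-rground-ValiantsHypothesis-FeketeSOS-2de3eee4-0)
- 2026-08-24T10:48:49Z · DORMANT — reconciler: no traction for 6.7 d (last activity item-evidence-added at 2026-08-17T17:00:36Z); parked, not closed — `ledger route dormant route-ValiantsHypothes (operator:999:3973698)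
- 2026-08-27T22:33:03Z · REACTIVATED — reconciler: reactivated — activity item-evidence-added at 2026-08-27T20:17:40Z after parking at 2026-08-24T10:48:49Z (operator:999:2536293)
- 2026-09-02T21:52:24Z · DORMANT — reconciler: no traction for 5 d (last activity statement-checked at 2026-08-28T21:09:06Z); parked, not closed — `ledger route dormant route-ValiantsHypothesis-F (operator:999:437015)

sub-problem: ValiantsHypothesis · status: dormant · opened planner-plancard-ValiantsHypothesis-ValiantsH-e9635114-0 2026-08-15T11:26:57Z · rev 8 · ledger route-ValiantsHypothesis-FeketeSOS
GENERATED by the gate from the ledger (D-0016/17). Provers cite these decls: `theorem foo : Summit.ValiantsHypothesis.ValiantsHypothesis.Theses.FeketeSOS.<Decl> := …` in Summits/ValiantsHypothesis/ValiantsHypothesis/Theorems/<Name>.lean.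
-/

namespace Summit.ValiantsHypothesis.ValiantsHypothesis.Theses.FeketeSOS

open scoped BigOperators Topology Manifold Classical MeasureTheory ProbabilityTheory Matrix InnerProductSpace ComplexConjugate ContinuousMap
open Filter Set Function TopologicalSpace MeasureTheory

attribute [summit_statement] _root_.ValiantsHypothesis

open Literature.PNP

/-- item stmt-ValiantsHypothesis-3995 · crux · rank 2 · closed · proved by Summit.ValiantsHypothesis.ValiantsHypothesis.Theorems.FeketeSOSAssemblyMagnification.sosMagnification @ d5eeccc69781 (prover) · by planner
why it might fail: No mathematical risk left: all 7 registered stubs of line sml-polarised-transport are accepted theorems (p78989 p76871 p76453 p78996 p76688 p76797 p77095); only the composition FeketeSOSSOSMagnification.lean awaits resubmission (p79173/p79388 bounced for gate restart).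
sources: DuttaSaxenaThierauf2021, DuttaSaxenaThierauf2024, Valiant1979, Burgisser2000, ValiantSkyumBerkowitzRackoff1983, Summits/ValiantsHypothesis/ValiantsHypothesis/Cruxes/SOSMagnification/NOTES.md
[crux] DST magnification for the Fekete family (named fact, unproved in tree; filed FIRST by the
plancard rule): if for some δ > 0 and all large primes p every representation F_p = Σ_{i<s} c_i g_i²
over ℂ with s ≤ p^δ and deg g_i ≤ p² has Σ_i |supp g_i| ≥ p^{1/2+δ}, then VP_ℂ ≠ VNP_ℂ. Proof route:
DuttaSaxenaThierauf2024 Thm 3.2/3.9 with constant k ≥ 6^{1/δ}+1, d = kⁿ − 1, f_d := F_{p_n} for p_n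
the largest prime ≤ kⁿ (Bertrand: p_n > kⁿ/2 ≥ (k−1)ⁿ), Lemma 3.1 (circuit of size S ⇒ (S·n)^{O(log
n)} squares of degree ≤ n/2) or Lemma 3.8, inverse multilinear Kronecker map (sparsity ≤ C(kn+n/2,
n/2) ≤ d^{1/2+δ/2}, degree < n·kⁿ ≤ p², Remark 2 after Thm 3.2), and P_{k,n} ∈ VNP by Valiant's
criterion (Thm 2.2; tree: ValiantCriterion.isVNPFamily_circuitSum) with p_n hard-wired: (m|p_n) =
[QR] − [QNR] is P/poly in the kn indicator bits. [difficulty: XL] -/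
@[route_item "route-ValiantsHypothesis-FeketeSOS"]
def SOSMagnification : Prop :=
  (∃ δ : ℝ, 0 < δ ∧ ∃ p₀ : ℕ, ∀ (p : ℕ) [Fact p.Prime], p₀ ≤ p → ∀ (s : ℕ) (c : Fin s → ℂ) (g : Fin s → Polynomial ℂ), (s : ℝ) ≤ (p : ℝ) ^ δ → (∀ i, (g i).natDegree ≤ p ^ 2) → (∑ i, Polynomial.C (c i) * g i ^ 2) = ∑ m ∈ Finset.range p, Polynomial.C ((legendreSym p m : ℤ) : ℂ) * Polynomial.X ^ m → (p : ℝ) ^ (1 / 2 + δ) ≤ ∑ i, ((g i).support.card : ℝ)) → ValiantsHypothesis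

-- `SOSMagnification` holds: proved by `Summit.ValiantsHypothesis.ValiantsHypothesis.Theorems.FeketeSOSAssemblyMagnification.sosMagnification` @ d5eeccc69781 (its module imports this route file, so no `_holds` link can be stated here).

/-- item stmt-ValiantsHypothesis-14989 · crux · rank 4 · open · by planner
why it might fail: In char p, order-vs-sparsity bounds for ≥2 products are FALSE near the socle ((X−1)^{p−1} = [a][b]_{x^a}+x^{ab}[c], support ≤3√p+3; θ-ladder): the invariant must die at the socle yet bite at depth (p−1)/2 — none known; Paley-type sign-pattern questions may hide in it.
sources: DuttaSaxenaThierauf2024, MinacNguyenDuytan2023, Hajos1953, RothSeroussi1986, KoiranPortierTavenas2015, AlyWinterhof2006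
[crux] (★) the characteristic-p shadow of X, child 1 of the glued split CharPSparseSOS →
SublinearShadow → FeketeSOSHard (glue proved in the planner's Sketch.lean and inlined in `closes`):
∃ δ > 0 ∃ p₀ ∀ primes p ≥ p₀ ∀ fields K of characteristic p, every CYCLIC representation X^p − 1 ∣
Σ_{i<s} c_i g_i² − F̄_p (F̄_p = Σ_{m<p} (m|p) X^m read in K, s ≤ p^δ, deg g_i < p) has Σ_i |supp
g_i| ≥ p^{1/2+δ}. Equivalent picture: in k[x]/(x^p − 1) ≅ k[z]/(z^p) (x = e^z) one has F̄_p =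
−z^{(p−1)/2}/((p−1)/2)! EXACTLY (twisted moments Σ χ(n)n^u ≡ −[u = (p−1)/2]), and a t-sparse g is a
t-term exponential sum, an element of a d/dz-stable space with spectrum supp g ⊂ 𝔽_p — so (★) says
the monomial z^{(p−1)/2} is not a short weighted sum of squares of sparse exponential sums. WHY
EASIER than X (it is a transfer target, neither weaker nor stronger): finite field, no archimedean
place, no Galois bookkeeping, target a monomial, Hajós / Wronskians / divide-and-derive exact,
finitely falsifiable per p. Known: s = 1 ⇒ |S| ≥ (p+1)/2 (LRS); s = 2 ⇔ one product ⇒ (p+3)/2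
(FeketeNoSparseSplitCyclic, landed); non-cancelling reps ⇒ a square with ≥ (p+3)/4 monomials
(support item CharPSOSOrderDichotomy); all ex -/
@[route_item "route-ValiantsHypothesis-FeketeSOS"]
def CharPSparseSOS : Prop :=
  ∃ δ : ℝ, 0 < δ ∧ ∃ p₀ : ℕ, ∀ (p : ℕ) [Fact p.Prime], p₀ ≤ p → ∀ (K : Type) [Field K] [CharP K p] (s : ℕ) (c : Fin s → K) (g : Fin s → Polynomial K), (s : ℝ) ≤ (p : ℝ) ^ δ → (∀ i, (g i).natDegree < p) → ((Polynomial.X : Polynomial K) ^ p - 1 ∣ (∑ i, Polynomial.C (c i) * g i ^ 2) - ∑ m ∈ Finset.range p, Polynomial.C ((legendreSym p m : ℤ) : K) * Polynomial.X ^ m) → (p : ℝ) ^ (1 / 2 + δ) ≤ ∑ i, ((g i).support.card : ℝ)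

/-- item stmt-ValiantsHypothesis-14990 · crux · rank 5 · open · by planner
why it might fail: Forced p-adic cancellation of unbounded depth (constituents congruent mod 𝔭: Σ_j χ(j)U_p(ζ^j x) = G·F_p with v(G⁻¹)<0; Jacobi square Ψ² ≡ J·F_p has depth 1 at 𝔭|J); de-bordering beyond flattenings has no engine (GCT), DDS de-border only bounded top fan-in.
sources: DuttaDwivediSaxena2022, DuttaSaxenaThierauf2024, MinacNguyenDuytan2023, Literature/RingTheory/Valuation/AlgClosedResidue.lean, Literature/RingTheory/Valuation/RootReduction.lean, Summits/ValiantsHypothesis/ValiantsHypothesis/Cruxes/FeketeSOSHard/TRIAGE-r1-2.md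
[crux] de-bordering transfer, child 2 of the glued split CharPSparseSOS → SublinearShadow →
FeketeSOSHard: ∃ A, p₁ ∀ primes p ≥ p₁ ∀ s, c, g with deg g_i ≤ p², (Σ|supp g_i|)⁴ ≤ p³ and Σ c_i
g_i² = F_p over ℂ, there exist a field K of characteristic p, d ≤ (s+1)^A, c′ : Fin d → K, g′_j ∈
K[X] of degree < p with Σ_j |supp g′_j| ≤ (s+1)^A·Σ_i |supp g_i| and X^p − 1 ∣ Σ c′_j g′_j² − F̄_p.
Content: a complex representation of SUBLINEAR cost (support-sum ≤ p^{3/4}) has a characteristic-p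
representation of polynomially comparable cost. DEPTH 0 — some valuation ring O of ℂ with p ∈ 𝔪_O
makes every term c_i g_i² O-integral — is provable now with d = s, A = 1 (support item
DepthZeroShadow: per-term Gauss normalisation, residue field, fold exponents mod p; the sibling's
stub_primitiveReduction p82759 is the one-product case). POSITIVE DEPTH — at every place the terms
cancel p-adically; modulo p the representation is a border decomposition Σ ĉ_i G_i(Π)² =
Π^v·unit·F̄_p over Λ = k[Π]/(Π^e) — is the open core: descend through the cancelling layers
(Teichmüller digits of fewnomials are fewnomials on the same supports; Gauss-orthonormal basis of
span(g_i) by the maximal-minor trick, cost ≤ factor -/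
@[route_item "route-ValiantsHypothesis-FeketeSOS"]
def SublinearShadow : Prop :=
  ∃ A p₁ : ℕ, ∀ (p : ℕ) [Fact p.Prime], p₁ ≤ p → ∀ (s : ℕ) (c : Fin s → ℂ) (g : Fin s → Polynomial ℂ), (∀ i, (g i).natDegree ≤ p ^ 2) → (∑ i, (g i).support.card) ^ 4 ≤ p ^ 3 → (∑ i, Polynomial.C (c i) * g i ^ 2) = ∑ m ∈ Finset.range p, Polynomial.C ((legendreSym p m : ℤ) : ℂ) * Polynomial.X ^ m → ∃ (K : Type) (_ : Field K) (_ : CharP K p) (d : ℕ) (c' : Fin d → K) (g' : Fin d → Polynomial K), d ≤ (s + 1) ^ A ∧ (∀ j, (g' j).natDegree < p) ∧ (∑ j, (g' j).support.card) ≤ (s + 1) ^ A * ∑ i, (g i).support.card ∧ ((Polynomial.X : Polynomial K) ^ p - 1 ∣ (∑ j, Polynomial.C (c' j) * g' j ^ 2) - ∑ m ∈ Finset.range p, Polynomial.C ((legendreSym p m : ℤ) : K) * Polynomial.X ^ m)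

/-- item stmt-ValiantsHypothesis-3996 · aside · rank 3 · open · by planner
why it might fail: A Gauss/Jacobi-sum identity could write F_p with p^{o(1)} squares of ~√p-sparse g_i that cancel p-adically at EVERY place (cancelling identities exist: Ψ² ≡ J·F_p mod x^p−1, depth 1 at 𝔭|J); no de-bordering engine beyond bounded top fan-in; (★) itself has no engine yet.
sources: DuttaSaxenaThierauf2024, MinacNguyenDuytan2023, DuttaDwivediSaxena2022, ConreyEtAl2000, HansonPetridis2020, Summits/ValiantsHypothesis/ValiantsHypothesis/Cruxes/FeketeSOSHard/Ideas/border-depth-dichotomy.md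
[crux] the thesis X (card K1): ∃ δ > 0 ∃ p₀ ∀ primes p ≥ p₀, every F_p = Σ_{i<s} c_i g_i² over ℂ
with s ≤ p^δ squares of degree ≤ p² has support-sum Σ_i |supp g_i| ≥ p^{1/2+δ}. Structure available:
Σ_i |S_i|(|S_i|+1)/2 ≥ p−1 (S_i = supp g_i) forces a square with |S_i| ≥ p^{1/2−δ}; with s ≤ p^δ
squares essentially all of [1, p−1] is covered by ≤ p^δ fat sumsets S_i + S_i with Σ|S_i| <
p^{1/2+δ}, i.e. near-extremal additive coverings, on which the coefficient identities Σ_i c_i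
Σ_{a+b=n} g_i(a) g_i(b) = χ_p(n) (n < p), = 0 (n ≥ p) impose near-rank-s sign patterns of the
Paley–Hankel matrix (χ_p(a+b)); the exponent must come from Balog–Szemerédi–Gowers-type structure of
the few fat S_i combined with bilinear character-sum bounds (reduction mod x^p − 1 gives the cleaner
cyclic form Σ_i c_i ĝ_i(a)² = G(χ_p)·χ_p(a) on ℤ/p). [difficulty: open-problem] -/
@[route_item "route-ValiantsHypothesis-FeketeSOS"]
def FeketeSOSHard : Prop :=
  ∃ δ : ℝ, 0 < δ ∧ ∃ p₀ : ℕ, ∀ (p : ℕ) [Fact p.Prime], p₀ ≤ p → ∀ (s : ℕ) (c : Fin s → ℂ) (g : Fin s → Polynomial ℂ), (s : ℝ) ≤ (p : ℝ) ^ δ → (∀ i, (g i).natDegree ≤ p ^ 2) → (∑ i, Polynomial.C (c i) * g i ^ 2) = ∑ m ∈ Finset.range p, Polynomial.C ((legendreSym p m : ℤ) : ℂ) * Polynomial.X ^ m → (p : ℝ) ^ (1 / 2 + δ) ≤ ∑ i, ((g i).support.card : ℝ)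

/-- item stmt-ValiantsHypothesis-3997 · support · rank 4 · closed · proved by Summit.ValiantsHypothesis.ValiantsHypothesis.Theorems.FeketeNoSparseSplitCyclic.FeketeNoSparseSplit_of @ dd1cf676b8d7 (prover) · by planner
why it might fail: Over ℂ F_p splits into linear factors: a root-partition statement; ~50.07% of the zeros lie on |z|=1 (ConreyEtAl2000) and x^n−1 = (x^{n/2}−1)(x^{n/2}+1) shows unit-circle zeros do not obstruct sparse factors; no sparsity lower bound for complex factors of a ±1-polynomial beyond counting is known.
sources: ConreyEtAl2000, DuttaSaxenaThierauf2024, arXiv:2206.11778, HansonPetridis2020, arXiv:2111.05256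
[crux] the two-squares case of X in factorised form (card K2, rank 3 there): ∃ δ > 0 ∃ p₀ ∀ primes p
≥ p₀, every factorisation F_p = A·B in ℂ[x] has |supp A| + |supp B| ≥ p^{1/2+δ}. (c₀g₀² + c₁g₁² =
(ag₀ + ibg₁)(ag₀ − ibg₁), a² = c₀, b² = c₁, so this is exactly "no SOS representation with s ≤ 2 and
support-sum < p^{1/2+δ}/2", see SplitOfTwoSquares; trivial splittings x·(F_p/x), (x² − x)·Q have a
dense factor.) A sparse splitting forces supp A + supp B ⊇ [1, p−1] with |supp A|·|supp B| ≤
p^{1+2δ}: a near-tiling of the interval by two sets (digit-system structure), against which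
(χ_p(a+b))_{a ∈ supp A, b ∈ supp B} must be close to the rank-one matrix A(a)B(b). [difficulty: L] -/
@[route_item "route-ValiantsHypothesis-FeketeSOS"]
def FeketeNoSparseSplit : Prop :=
  ∃ δ : ℝ, 0 < δ ∧ ∃ p₀ : ℕ, ∀ (p : ℕ) [Fact p.Prime], p₀ ≤ p → ∀ (A B : Polynomial ℂ), A * B = ∑ m ∈ Finset.range p, Polynomial.C ((legendreSym p m : ℤ) : ℂ) * Polynomial.X ^ m → (p : ℝ) ^ (1 / 2 + δ) ≤ (A.support.card : ℝ) + (B.support.card : ℝ)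

-- `FeketeNoSparseSplit` holds: proved by `Summit.ValiantsHypothesis.ValiantsHypothesis.Theorems.FeketeNoSparseSplitCyclic.FeketeNoSparseSplit_of` @ dd1cf676b8d7 (its module imports this route file, so no `_holds` link can be stated here).

/-- item stmt-ValiantsHypothesis-3998 · support · rank 5 · open · by planner
why it might fail: For s₀ ≥ 3 the factorisation trick is gone; s₀ near-Sidon supports of size √(2p/s₀) pass every counting constraint, and excluding their sign patterns contains Paley-clique-type questions at |S| ~ √p, where the Hanson–Petridis bound √(p/2)+1 is tight to a constant: an exponent may be out of reach.
sources: HansonPetridis2020, Sarkozy2012, BourgainKatzTao2004, TaoVu2006, DuttaSaxenaThierauf2024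
[crux] the bounded-top-fan-in rung between FeketeNoSparseSplit (s₀ = 2) and X (s ≤ p^δ): for every
fixed s₀, ∃ δ = δ(s₀) > 0 ∃ p₀ ∀ primes p ≥ p₀, every F_p = Σ_{i<s₀} c_i g_i² with deg g_i ≤ p² has
Σ_i |supp g_i| ≥ p^{1/2+δ}. Here all relevant squares are fat (some |S_i| ≥ √(p/s₀)); in the
near-Sidon regime |S_i + S_i| ≈ |S_i|²/2 the identities read 2c_i g_i(a)g_i(b) = χ_p(a+b) on most of
S_i × S_i, a rank-one ±-pattern of the Paley sum graph on a set of size ~√(2p/s₀) — the regime of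
HansonPetridis2020 (A + B ⊆ QR ⇒ |A||B| ≲ p/2), to be made robust under p^{O(δ)} collisions and s₀
overlapping sumsets. [deps: FeketeNoSparseSplit] [difficulty: L] -/
@[route_item "route-ValiantsHypothesis-FeketeSOS"]
def FeketeBoundedFanin : Prop :=
  ∀ s₀ : ℕ, ∃ δ : ℝ, 0 < δ ∧ ∃ p₀ : ℕ, ∀ (p : ℕ) [Fact p.Prime], p₀ ≤ p → ∀ (c : Fin s₀ → ℂ) (g : Fin s₀ → Polynomial ℂ), (∀ i, (g i).natDegree ≤ p ^ 2) → (∑ i, Polynomial.C (c i) * g i ^ 2) = ∑ m ∈ Finset.range p, Polynomial.C ((legendreSym p m : ℤ) : ℂ) * Polynomial.X ^ m → (p : ℝ) ^ (1 / 2 + δ) ≤ ∑ i, ((g i).support.card : ℝ)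

/-- item stmt-ValiantsHypothesis-14991 · support · rank 9 · closed · proved by Summit.ValiantsHypothesis.ValiantsHypothesis.Theorems.charPSOSOrderDichotomy_proof (prover) · by planner
sources: MinacNguyenDuytan2023, Hajos1953, RothSeroussi1986, Summits/ValiantsHypothesis/ValiantsHypothesis/Theorems/FeketeSOSFeketeNoSparseSplitCharPFewnomial.lean, Summits/ValiantsHypothesis/ValiantsHypothesis/Theorems/FeketeSOSFeketeNoSparseSplitFeketeModPOrder.lean
[support] FIRST LEMMA of the (★) attack (fat-or-cancel dichotomy at the place over p), provable now:
over a field K of characteristic p ≠ 2, if X^p − 1 ∣ Σ_{i<s} c_i g_i² − F̄_p with deg g_i < p, then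
EITHER some live square (c_i ≠ 0) has ≥ (p+3)/4 monomials, OR the minimal (X−1)-order m among live
squares satisfies 2m < (p−1)/2 and the leading coefficients cancel: Σ_{i live, ord₁ g_i = m}
c_i·(h_i(1))² = 0 with h_i = g_i /ₘ (X−1)^m. Proof (paper-checked by both triagers of crux 3996):
(X−1)^{(p−1)/2} ∥ F̄_p (Euler + power sums = landed FeketeNoSparseSplitCyclic.stub_feketeModPOrder,
exact order by LeverExactOrder), X^p − 1 = (X−1)^p, ord₁(c g²) = 2·ord₁ g, char-p Hajós ord₁ g ≤
|supp g| − 1 for deg g < p (landed cpf_main / stub_charPFewnomial), rootMultiplicity additivity; if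
2m ≥ (p−1)/2 the square attaining m is fat, else dividing by (X−1)^{2m} and evaluating at 1 gives
the cancellation. Typed from Cruxes/FeketeSOSHard/Sketch-ideator1.lean `CharPSOSOrderDichotomy` (u
absorbed into c). Note: for p ≡ 3 (mod 4) the fat branch is empty ((p−1)/2 odd), so every char-p
representation is cancelling at the y-adic slice. [difficulty: provable-now (S/M)] -/
@[route_item "route-ValiantsHypothesis-FeketeSOS"]
def CharPSOSOrderDichotomy : Prop :=
  ∀ (K : Type) [Field K] (p : ℕ) [Fact p.Prime] [CharP K p], p ≠ 2 → ∀ (s : ℕ) (c : Fin s → K) (g : Fin s → Polynomial K), (∀ i, (g i).natDegree < p) → ((Polynomial.X : Polynomial K) ^ p - 1 ∣ (∑ i, Polynomial.C (c i) * g i ^ 2) - ∑ m ∈ Finset.range p, Polynomial.C ((legendreSym p m : ℤ) : K) * Polynomial.X ^ m) → (∃ i, c i ≠ 0 ∧ (p + 3) / 4 ≤ (g i).support.card) ∨ (∃ m : ℕ, 2 * m < (p - 1) / 2 ∧ (∀ i, c i ≠ 0 → g i ≠ 0 → m ≤ (g i).rootMultiplicity 1) ∧ (∃ i, c i ≠ 0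 ∧ g i ≠ 0 ∧ (g i).rootMultiplicity 1 = m) ∧ ∑ i ∈ Finset.univ.filter (fun i => c i ≠ 0 ∧ g i ≠ 0 ∧ (g i).rootMultiplicity 1 = m), c i * ((Polynomial.divByMonic (g i) ((Polynomial.X - Polynomial.C 1) ^ m)).eval 1) ^ 2 = 0)

-- `CharPSOSOrderDichotomy` holds: proved by `Summit.ValiantsHypothesis.ValiantsHypothesis.Theorems.charPSOSOrderDichotomy_proof` (its module imports this route file, so no `_holds` link can be stated here).

/-- item stmt-ValiantsHypothesis-14992 · support · rank 9 · closed · proved by Summit.ValiantsHypothesis.ValiantsHypothesis.Theorems.depthZeroShadow_proof (prover) · by planner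
sources: Literature/RingTheory/Valuation/AlgClosedResidue.lean, Literature/RingTheory/Valuation/RootReduction.lean, Summits/ValiantsHypothesis/ValiantsHypothesis/Theorems/FeketeSOSFeketeNoSparseSplitPrimitiveReduction.lean
[support] depth-0 case of SublinearShadow (good reduction at some place of ℂ above p), provable now:
if Σ_{i<s} c_i g_i² = F_p over ℂ and some valuation subring O of ℂ with p ∈ 𝔪_O contains every
coefficient of every TERM c_i g_i², then over K = residue field of O (characteristic p by
Literature.RingTheory.Valuation.charP_residueField) there are c′ : Fin s → K and g′_j of degree < p
with |supp g′_j| ≤ |supp g_j| and X^p − 1 ∣ Σ c′_j g′_j² − F̄_p. Proof: for g_j ≠ 0 pick a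
coefficient a_j of maximal valuation (exists_valuation_coeff_eq_gaussVal), h_j := g_j/a_j is
O-primitive, c_j a_j² ∈ O because gaussVal(c_j g_j²) ≤ 1 and gaussVal(h_j²) = 1 (gaussVal_C_mul,
gaussVal_map_eq_one); reduce Σ (c_j a_j²)‾·h̄_j² = F̄_p in K[X] and fold exponents modulo p
(supports only shrink). The one-product version is the landed
FeketeNoSparseSplitCyclic.stub_primitiveReduction (p82759,
Theorems/FeketeSOSFeketeNoSparseSplitPrimitiveReduction.lean). Plugs into SublinearShadow with d =
s, A = 1 (checked in the planner's Sketch.lean). [difficulty: provable-now (M)] -/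
@[route_item "route-ValiantsHypothesis-FeketeSOS"]
def DepthZeroShadow : Prop :=
  ∀ (p : ℕ) [Fact p.Prime] (s : ℕ) (c : Fin s → ℂ) (g : Fin s → Polynomial ℂ), (∑ i, Polynomial.C (c i) * g i ^ 2) = ∑ m ∈ Finset.range p, Polynomial.C ((legendreSym p m : ℤ) : ℂ) * Polynomial.X ^ m → (∃ O : ValuationSubring ℂ, ((p : ℕ) : O) ∈ IsLocalRing.maximalIdeal O ∧ ∀ i n, (Polynomial.C (c i) * g i ^ 2).coeff n ∈ O) → ∃ (K : Type) (_ : Field K) (_ : CharP K p) (c' : Fin s → K) (g' : Fin s → Polynomial K), (∀ j, (g' j).natDegree < p) ∧ (∀ j, (g' j).support.card ≤ (g j).support.card) ∧ ((Polynomial.X : Polynomial K) ^ p - 1 ∣ (∑ j, Polynomial.C (c' j) * g' j ^ 2) - ∑ m ∈ Finset.range p, Polynomial.C ((legendreSym p m : ℤ) : K) * Polynomial.X ^ m)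

-- `DepthZeroShadow` holds: proved by `Summit.ValiantsHypothesis.ValiantsHypothesis.Theorems.depthZeroShadow_proof` (its module imports this route file, so no `_holds` link can be stated here).

/-- item stmt-ValiantsHypothesis-24311 · support · rank 9 · open · by planner
[support · CONJECTURE DEPENDENCY · to be HELD, never staffed] The Paley graph conjecture below the
1/2 barrier (Chor–Goldreich 1988 two-source extraction from the Paley graph below min-entropy rate
1/2; Chung 1994 Conj. 2.2; Satake 2024 Problem 8 / Cor. 21; ⟺ Paley-ETF RIP beyond √p,
Bandeira–Fickus–Mixon–Wong 2013 §6, listed OPEN 2026): for SOME α < 1/2 there are β, C > 0 with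
|Σ_{s∈S,t∈T} χ_p(s−t)| ≤ C·p^{−β}·|S||T| for all S, T ⊆ 𝔽_p of size > p^α at all large primes. This
decl is DEFINITIONALLY (Iff.rfl, tenure sketch fek/Sketch_PGC.lean rc 0) the tree's `@[conjecture]
def Summit.ValiantsHypothesis.ValiantsHypothesis.Theorems.PaleyGraphConjectureBelowHalf`
(Theorems/FeketeSOSPaleyGraphConjecture.lean, p590245), inlined in Mathlib vocabulary because the
route file does not import that module. WHY IT IS AN ITEM (rules 4b: an unproven conjecture a line
leans on is a route item or a declared bridge; director-valiant g9 REQUESTS l.22994 (i) / l.23083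
(b)(2)): the registered line `paley_rip_v3` on crux FeketeSOSHard (stmt-3996) has stub
`stub_paleyFlatRIP` which is EQUIVALENT to this conjecture
(`flatRIP_iff_paleyGraphConjectureBelowHalf`, kernel) — the line is therefore a CONDITIONA -/
@[route_item "route-ValiantsHypothesis-FeketeSOS"]
def PaleyGraphConjectureBelowHalfDep : Prop :=
  ∃ α : ℝ, α < 1 / 2 ∧ ∃ β : ℝ, 0 < β ∧ ∃ C : ℝ, 0 < C ∧ ∃ p₁ : ℕ, ∀ (p : ℕ) [Fact p.Prime], p₁ ≤ p → ∀ (S T : Finset (ZMod p)), (p : ℝ) ^ α < (S.card : ℝ) → (p : ℝ) ^ α < (T.card : ℝ) → |∑ s ∈ S, ∑ t ∈ T, ((quadraticChar (ZMod p) (s - t) : ℤ) : ℝ)| ≤ C * (p : ℝ) ^ (-β) * (S.card : ℝ) * (T.card : ℝ)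

/-- item stmt-ValiantsHypothesis-3999 · support · rank 9 · closed · proved by Summit.ValiantsHypothesis.ValiantsHypothesis.Theorems.FeketeSOS.trivialSupportBound_proof @ d93e1a83de95 (prover) · by planner
sources: DuttaSaxenaThierauf2024
[support] the trivial counting bound in our typing (DST24 eq. (3): √(sp f) ≤ S(f)): for every prime
p and every representation Σ_{i<s} c_i g_i² = F_p, the support-sum S = Σ_i |supp g_i| satisfies
S(S+1)/2 ≥ p − 1 (supp F_p = [1, p−1]; supp g_i² ⊆ S_i + S_i has ≤ |S_i|(|S_i|+1)/2 elements;
Σ|S_i|² ≤ S²). Pins the inlined definitions for provers. [difficulty: provable-now] -/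
@[route_item "route-ValiantsHypothesis-FeketeSOS"]
def TrivialSupportBound : Prop :=
  ∀ (p : ℕ) [Fact p.Prime] (s : ℕ) (c : Fin s → ℂ) (g : Fin s → Polynomial ℂ), (∑ i, Polynomial.C (c i) * g i ^ 2) = ∑ m ∈ Finset.range p, Polynomial.C ((legendreSym p m : ℤ) : ℂ) * Polynomial.X ^ m → ((p : ℝ) - 1) ≤ (∑ i, ((g i).support.card : ℝ)) * ((∑ i, ((g i).support.card : ℝ)) + 1) / 2

-- `TrivialSupportBound` holds: proved by `Summit.ValiantsHypothesis.ValiantsHypothesis.Theorems.FeketeSOS.trivialSupportBound_proof` @ d93e1a83de95 (its module imports this route file, so no `_holds` link can be stated here).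

/-- item stmt-ValiantsHypothesis-4000 · support · rank 9 · closed · proved by Summit.ValiantsHypothesis.ValiantsHypothesis.Theorems.thinSquaresCovering_proof (prover) · by planner
sources: DuttaSaxenaThierauf2021
[support] the covering lemma of the card (reduction to fat squares): if every g_i has |supp g_i| ≤ M
then 2(p − 1) ≤ (M + 1)·Σ_i |supp g_i|; hence representations using only squares of sparsity ≤
p^{1/2−δ} have support-sum ≥ p^{1/2+δ}, and X need only exclude representations carrying fat
squares. [difficulty: provable-now] -/
@[route_item "route-ValiantsHypothesis-FeketeSOS"]
def ThinSquaresCovering : Prop :=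
  ∀ (p : ℕ) [Fact p.Prime] (s M : ℕ) (c : Fin s → ℂ) (g : Fin s → Polynomial ℂ), (∀ i, (g i).support.card ≤ M) → (∑ i, Polynomial.C (c i) * g i ^ 2) = ∑ m ∈ Finset.range p, Polynomial.C ((legendreSym p m : ℤ) : ℂ) * Polynomial.X ^ m → 2 * ((p : ℝ) - 1) ≤ ((M : ℝ) + 1) * ∑ i, ((g i).support.card : ℝ)

-- `ThinSquaresCovering` holds: proved by `Summit.ValiantsHypothesis.ValiantsHypothesis.Theorems.thinSquaresCovering_proof` (its module imports this route file, so no `_holds` link can be stated here).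

/-- item stmt-ValiantsHypothesis-4001 · support · rank 9 · closed · proved by Summit.ValiantsHypothesis.ValiantsHypothesis.Theorems.FeketeSOSSplitOfTwoSquares.splitOfTwoSquares_proof @ b2b4755d1d36 (prover) · by planner
sources: DuttaSaxenaThierauf2024
[support] two squares are a splitting (glue FeketeNoSparseSplit → the s ≤ 2 case of X): if c₀g₀² +
c₁g₁² = F_p over ℂ then F_p = A·B with A = ag₀ + ibg₁, B = ag₀ − ibg₁ (a² = c₀, b² = c₁), so |supp
A| + |supp B| ≤ 2(|supp g₀| + |supp g₁|). [difficulty: provable-now] -/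
@[route_item "route-ValiantsHypothesis-FeketeSOS"]
def SplitOfTwoSquares : Prop :=
  ∀ (p : ℕ) [Fact p.Prime] (c : Fin 2 → ℂ) (g : Fin 2 → Polynomial ℂ), (∑ i, Polynomial.C (c i) * g i ^ 2) = ∑ m ∈ Finset.range p, Polynomial.C ((legendreSym p m : ℤ) : ℂ) * Polynomial.X ^ m → ∃ A B : Polynomial ℂ, A * B = ∑ m ∈ Finset.range p, Polynomial.C ((legendreSym p m : ℤ) : ℂ) * Polynomial.X ^ m ∧ A.support.card + B.support.card ≤ 2 * ((g 0).support.card + (g 1).support.card)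

-- `SplitOfTwoSquares` holds: proved by `Summit.ValiantsHypothesis.ValiantsHypothesis.Theorems.FeketeSOSSplitOfTwoSquares.splitOfTwoSquares_proof` @ b2b4755d1d36 (its module imports this route file, so no `_holds` link can be stated here).

-- earlier Assembly (stmt-ValiantsHypothesis-4002, replaced 2026-08-16T06:46:59Z -> stmt-ValiantsHypothesis-14917): moot by None — SOSMagnification → FeketeSOSHard → ValiantsHypothesis
/-- item stmt-ValiantsHypothesis-14917 · assembly · rank 1 · closed · proved by Summit.ValiantsHypothesis.ValiantsHypothesis.Theorems.FeketeSOSAssemblyMagnification.assembly_proof @ d5eeccc69781 (prover) · by planner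
why it might fail: Fails only with SOSMagnification: DST24 Thm 3.2/3.9 + Remark 2 and Lemma 3.1 must survive prime-only indexing (Bertrand padding) and the few-squares / degree ≤ p² restriction of X — audited true (Cruxes/SOSMagnification/Disproof.lean finding 5; seven stubs landed).
sources: DuttaSaxenaThierauf2024, DuttaSaxenaThierauf2021
[assembly] FeketeSOSHard → ValiantsHypothesis: the thesis X alone yields the sub-problem Statement
`_root_.ValiantsHypothesis` — the content of the bridge crux SOSMagnification
(stmt-ValiantsHypothesis-3995), which inlines X verbatim, so this item is SOSMagnification stated
over the decl FeketeSOSHard (definitionally equal: it closes by `fun h => ‹SOSMagnification› h` the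
moment stmt-3995 lands — its seven stubs are in tree — and conversely). Same shape as Depth4's
`Assembly := Depth4HomFour → ValiantsHypothesis`. The deciding theorem is unchanged, `closes (h₁ :
SOSMagnification) (h₂ : FeketeSOSHard) : _root_.ValiantsHypothesis := h₁ h₂`, i.e. closes = this
Assembly (from h₁) applied to h₂. Restated 2026-08-16 by route-repair (ground-failed): revs ≤ 2 had
Assembly := SOSMagnification → FeketeSOSHard → ValiantsHypothesis, the propositional tautology ((X →
VH) → X → VH) flagged ground.trivial (tauto); that legacy form stays proved as
stmt-ValiantsHypothesis-4002 in Theorems/FeketeSOSAssembly.lean (assembly_proof), which names the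
replaced constant by `unfold` and no longer elaborates against this render — operator: retire that
25-line file or re-point its proof to the SOSMagnificatio -/
@[route_item "route-ValiantsHypothesis-FeketeSOS"]
def Assembly : Prop :=
  FeketeSOSHard → ValiantsHypothesis

-- `Assembly` holds: proved by `Summit.ValiantsHypothesis.ValiantsHypothesis.Theorems.FeketeSOSAssemblyMagnification.assembly_proof` @ d5eeccc69781 (its module imports this route file, so no `_holds` link can be stated here).

/-! D-0027 §2.1 — DECIDING THEOREM (planner-authored via `route open/edit --closes-file`; by planner-promote-ValiantsHypothesis-FeketeSOS-2de3eee4-0 2026-08-16T07:13:32Z):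
its hypotheses are this route's items and its conclusion the sub-problem Statement (glue_lint), and it elaborates with this file. -/

@[closes "route-ValiantsHypothesis-FeketeSOS"] theorem closes (h₁ : SOSMagnification) (h₂ : CharPSparseSOS) (h₃ : SublinearShadow) :
    _root_.ValiantsHypothesis := by
  -- The thesis X = FeketeSOSHard is DERIVED from its two children (glued split along the char-p lever):
  -- (★) char-p sparse-SOS hardness of F̄_p  +  sublinear complex representations have cheap char-p shadows.
  have hX : FeketeSOSHard := by
    obtain ⟨δ', hδ', p₀', Hstar⟩ := h₂
    obtain ⟨A, p₁, Hsh⟩ := h₃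
    set M : ℝ := (A : ℝ) + 1 with hM
    have hM0 : (0 : ℝ) < M := by rw [hM]; have : (0:ℝ) ≤ A := Nat.cast_nonneg A; linarith
    set δ : ℝ := min (1 / 4) (δ' / (2 * M)) with hδdef
    have hδpos : 0 < δ := lt_min (by norm_num) (by positivity)
    have hδ4 : δ ≤ 1 / 4 := min_le_left _ _
    have hδM : δ * M ≤ δ' / 2 := by
      have h1 : δ ≤ δ' / (2 * M) := min_le_right _ _
      calc δ * M ≤ δ' / (2 * M) * M := mul_le_mul_of_nonneg_right h1 hM0.le
        _ = δ' / 2 := by field_simp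
    have hδA : δ * A ≤ δ' / 2 := by
      have : δ * (A : ℝ) ≤ δ * M := mul_le_mul_of_nonneg_left (by rw [hM]; linarith) hδpos.le
      exact this.trans hδM
    have hδA1 : δ * A + δ ≤ δ' / 2 := by
      have : δ * (A : ℝ) + δ = δ * M := by rw [hM]; ring
      rw [this]; exact hδM
    obtain ⟨N, hN⟩ : ∃ N : ℕ, ((2 : ℝ) ^ A) ^ (2 / δ') ≤ (N : ℝ) := ⟨_, Nat.le_ceil _⟩
    refine ⟨δ, hδpos, max p₀' (max p₁ (max N 2)), ?_⟩
    intro p _ hp s c g hs hdeg hrep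
    have hprime : p.Prime := Fact.out
    have hp₀' : p₀' ≤ p := le_trans (le_max_left _ _) hp
    have hp₁ : p₁ ≤ p := le_trans (le_trans (le_max_left _ _) (le_max_right _ _)) hp
    have hpN : N ≤ p := le_trans (le_trans (le_trans (le_max_left _ _) (le_max_right _ _)) (le_max_right _ _)) hp
    have hp1 : (1 : ℝ) ≤ (p : ℝ) := by exact_mod_cast hprime.one_lt.le
    have hp0 : (0 : ℝ) < (p : ℝ) := by linarith
    -- threshold: 2^A ≤ p^(δ'/2)
    have h2A : (2 : ℝ) ^ A ≤ (p : ℝ) ^ (δ' / 2) := by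
      have h2A0 : (0 : ℝ) ≤ (2 : ℝ) ^ A := by positivity
      have hbase : ((2 : ℝ) ^ A) ^ (2 / δ') ≤ (p : ℝ) := hN.trans (by exact_mod_cast hpN)
      have hb0 : (0 : ℝ) ≤ ((2 : ℝ) ^ A) ^ (2 / δ') := Real.rpow_nonneg h2A0 _
      have hmono : (((2 : ℝ) ^ A) ^ (2 / δ')) ^ (δ' / 2) ≤ (p : ℝ) ^ (δ' / 2) :=
        Real.rpow_le_rpow hb0 hbase (by positivity)
      have hid : (((2 : ℝ) ^ A) ^ (2 / δ')) ^ (δ' / 2) = (2 : ℝ) ^ A := by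
        rw [← Real.rpow_mul h2A0]
        have : (2 / δ') * (δ' / 2) = 1 := by field_simp
        rw [this, Real.rpow_one]
      rw [hid] at hmono
      exact hmono
    by_contra hlt
    push Not at hlt
    set S : ℕ := ∑ i, (g i).support.card with hS
    have hcastS : (∑ i, ((g i).support.card : ℝ)) = (S : ℝ) := by rw [hS]; push_cast; rfl
    rw [hcastS] at hlt
    -- Step 1: the representation is sublinear, S^4 ≤ p^3
    have h34 : (p : ℝ) ^ (1 / 2 + δ) ≤ (p : ℝ) ^ (3 / 4 : ℝ) :=
      Real.rpow_le_rpow_of_exponent_le hp1 (by linarith)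
    have hSlt : (S : ℝ) < (p : ℝ) ^ (3 / 4 : ℝ) := lt_of_lt_of_le hlt h34
    have hS4 : S ^ 4 ≤ p ^ 3 := by
      have hS0 : (0 : ℝ) ≤ (S : ℝ) := Nat.cast_nonneg S
      have h4 : (S : ℝ) ^ (4 : ℕ) < ((p : ℝ) ^ (3 / 4 : ℝ)) ^ (4 : ℕ) :=
        pow_lt_pow_left₀ hSlt hS0 (by norm_num)
      have e1 : ((p : ℝ) ^ (3 / 4 : ℝ)) ^ (4 : ℕ) = (p : ℝ) ^ (3 : ℕ) := by
        rw [← Real.rpow_natCast, ← Real.rpow_mul hp0.le]; norm_num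
      rw [e1] at h4
      have : ((S ^ 4 : ℕ) : ℝ) < ((p ^ 3 : ℕ) : ℝ) := by push_cast; exact h4
      exact le_of_lt (by exact_mod_cast this)
    -- Step 2: its char-p shadow (SublinearShadow)
    obtain ⟨K, instF, instC, d, c', g', hd, hdeg', hsupp', hdvd'⟩ := Hsh p hp₁ s c g hdeg hS4 hrep
    -- Step 3: the shadow has few squares, (d : ℝ) ≤ p ^ δ'
    have hpδ1 : (1 : ℝ) ≤ (p : ℝ) ^ δ := Real.one_le_rpow hp1 hδpos.le
    have hs1 : (s : ℝ) + 1 ≤ 2 * (p : ℝ) ^ δ := by linarith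
    have hsA : ((s : ℝ) + 1) ^ A ≤ (2 : ℝ) ^ A * (p : ℝ) ^ (δ * A) := by
      have h := pow_le_pow_left₀ (by positivity) hs1 A
      have e : (2 * (p : ℝ) ^ δ) ^ A = (2 : ℝ) ^ A * (p : ℝ) ^ (δ * A) := by
        rw [mul_pow, ← Real.rpow_natCast ((p : ℝ) ^ δ) A, ← Real.rpow_mul hp0.le]
      rw [e] at h; exact h
    have hbound : (2 : ℝ) ^ A * (p : ℝ) ^ (δ * A) ≤ (p : ℝ) ^ (δ' / 2) * (p : ℝ) ^ (δ * A) :=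
      mul_le_mul_of_nonneg_right h2A (Real.rpow_nonneg hp0.le _)
    have hdR : (d : ℝ) ≤ (p : ℝ) ^ δ' := by
      have h1 : (d : ℝ) ≤ ((s : ℝ) + 1) ^ A := by
        have : ((d : ℕ) : ℝ) ≤ (((s + 1) ^ A : ℕ) : ℝ) := by exact_mod_cast hd
        push_cast at this; exact this
      have h2 : (p : ℝ) ^ (δ' / 2) * (p : ℝ) ^ (δ * A) ≤ (p : ℝ) ^ δ' := by
        rw [← Real.rpow_add hp0]
        exact Real.rpow_le_rpow_of_exponent_le hp1 (by linarith)
      exact h1.trans (hsA.trans (hbound.trans h2))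
    -- Step 4: (★) in K, and the support chain contradicts S < p^(1/2+δ)
    have hstarK := Hstar p hp₀' K d c' g' hdR hdeg' hdvd'
    have hsum' : (∑ j, ((g' j).support.card : ℝ)) ≤ ((s : ℝ) + 1) ^ A * (S : ℝ) := by
      have : ((∑ j, (g' j).support.card : ℕ) : ℝ) ≤ (((s + 1) ^ A * S : ℕ) : ℝ) := by exact_mod_cast hsupp'
      push_cast at this
      have e : (∑ j, ((g' j).support.card : ℝ)) = ((∑ j, (g' j).support.card : ℕ) : ℝ) := by push_cast; rfl
      rw [e]; push_cast; exact this
    have hS0 : (0 : ℝ) ≤ (S : ℝ) := Nat.cast_nonneg S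
    have hlt2 : ((s : ℝ) + 1) ^ A * (S : ℝ) <
        (p : ℝ) ^ (δ' / 2) * (p : ℝ) ^ (δ * A) * (p : ℝ) ^ (1 / 2 + δ) := by
      have hc : ((s : ℝ) + 1) ^ A ≤ (p : ℝ) ^ (δ' / 2) * (p : ℝ) ^ (δ * A) := hsA.trans hbound
      have hcpos : (0 : ℝ) < (p : ℝ) ^ (δ' / 2) * (p : ℝ) ^ (δ * A) := by positivity
      calc ((s : ℝ) + 1) ^ A * (S : ℝ) ≤ (p : ℝ) ^ (δ' / 2) * (p : ℝ) ^ (δ * A) * (S : ℝ) :=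
            mul_le_mul_of_nonneg_right hc hS0
        _ < (p : ℝ) ^ (δ' / 2) * (p : ℝ) ^ (δ * A) * (p : ℝ) ^ (1 / 2 + δ) :=
            mul_lt_mul_of_pos_left hlt hcpos
    have hexp : (p : ℝ) ^ (δ' / 2) * (p : ℝ) ^ (δ * A) * (p : ℝ) ^ (1 / 2 + δ) ≤ (p : ℝ) ^ (1 / 2 + δ') := by
      rw [← Real.rpow_add hp0, ← Real.rpow_add hp0]
      exact Real.rpow_le_rpow_of_exponent_le hp1 (by linarith)
    exact lt_irrefl _ (lt_of_le_of_lt hstarK (lt_of_le_of_lt hsum' (lt_of_lt_of_le hlt2 hexp)))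
  -- DST magnification (crux SOSMagnification) turns X into VP ≠ VNP.
  exact h₁ hX

end Summit.ValiantsHypothesis.ValiantsHypothesis.Theses.FeketeSOS
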